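import Summits.NavierStokesRegularity.NavierStokesRegularity.Theorems.TypeILiouvilleTypeIliouvilleNoTypeIIEternalEnergyLiouvilleLineInvariantAxial
import Summits.NavierStokesRegularity.NavierStokesRegularity.Theorems.RellichScarSimilarityCovarianceRotationAB
import Literature.Analysis.FluidPDE.MildSolutionIsometryCovariance
import Literature.Analysis.FluidPDE.OseenZoomCovariance
import Mathlib.Analysis.InnerProductSpace.Projection.Reflection
import HarnessLib

/-!
# EEL′ on the 2½-dimensional stratum in ANY direction (crux `TypeIliouvilleNoTypeII`,
# stmt-NavierStokesRegularity-0056; rigidity residual EEL′ of the pressure-free eternal split)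

Helper file (theorems only).  `…EternalEnergyLiouvilleLineInvariantAxial.lean` proved that a member
of the EEL′ class (bounded eternal Oseen-mild smooth divergence-free `v` with `A_ess ≤ I < ∞` on all
parabolic balls) which is invariant under the translations along the coordinate direction `e₁`
vanishes.  The class and the conclusion are rotation invariant, so the coordinate direction is
immaterial:

* `lineInvariant_eq_zero_of_unit` — invariance under `x ↦ x + δ e` for ONE unit vector `e` forces
  `v ≡ 0`: conjugate by the reflection `R` exchanging `e₁` and `e` (Mathlib `reflection_sub`); the
  conjugate `R⁻¹ v(t, R ·)` is again in the class (`VectorCalculus.IsDivFree.conj_linearIsometryEquiv`,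
  `heatFlow_conj_linearIsometryEquiv`, `oseenDuhamel_symm_conj_linearIsometryEquiv`,
  `RellichScarSimilarityCovariance.cknAEss_conj`) and invariant along `e₁`;
* `lineInvariant_eq_zero_of_ne_zero` — the same for any nonzero direction;
* `eternalLiouvillePressureFree_lineInvariant_of_ne_zero` — **EEL′ holds for every profile admitting
  a translation-invariant direction**, in the exact `hEEL` shape.

The open core of EEL′ is therefore GENUINELY THREE-DIMENSIONAL: no member with a continuous
translation symmetry survives.  WHAT THIS IS NOT: not NS; EEL′ stays OPEN. [folklore]
-/

noncomputable section

-- the summit and its single problem share the name `NavierStokesRegularity` (D-0017 nested layout)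
set_option linter.dupNamespace false

open Set Function Filter Topology MeasureTheory Metric WithLp
open scoped NNReal ENNReal

namespace Summit.NavierStokesRegularity.NavierStokesRegularity.Theorems.TypeIliouvilleNoTypeII.TypeIIZoom

open Literature.Analysis Literature.Analysis.FluidPDE
open Summit.NavierStokesRegularity.NavierStokesRegularity.Theorems.RellichScarSimilarityCovariance
open Summit.NavierStokesRegularity.NavierStokesRegularity.Theorems.RellichScarSimilarityCovariance.LIE

variable {v : ℝ → EuclideanSpace ℝ (Fin 3) → EuclideanSpace ℝ (Fin 3)}

/-- `δ e₁` as a multiple of the unit coordinate vector. [folklore] -/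
theorem single_one_eq_smul (δ : ℝ) :
    (EuclideanSpace.single (1 : Fin 3) δ : EuclideanSpace ℝ (Fin 3)) =
      δ • EuclideanSpace.single (1 : Fin 3) (1 : ℝ) := by
  ext j
  fin_cases j <;> simp

/-- **Every member of the EEL′ class with a translation-invariant unit direction vanishes.**  Let
`v` be a bounded eternal Oseen-mild smooth divergence-free field with `A_ess ≤ I ≠ ∞` on all parabolic
balls, invariant under `x ↦ x + δ e` for a unit vector `e` and all `δ`.  Then `v ≡ 0` (conjugate by the
reflection exchanging `e₁` and `e` and apply `lineInvariant_eq_zero`). [cite: KochNadirashviliSereginSverak2009, Thm 5.1 and proof of Thm 6.2 (arXiv:0709.3599 pp. 9, 13)] -/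
theorem lineInvariant_eq_zero_of_unit (hv : ContDiff ℝ (⊤ : ℕ∞) (uncurry v))
    (hdiv : ∀ t, VectorCalculus.IsDivFree (v t))
    (hmild : ∀ s t : ℝ, s < t → ∀ x, v t x = heatFlow (v s) (t - s) x - oseenDuhamel 1 s v v t x)
    (hbdd : ∃ C : ℝ, ∀ t x, ‖v t x‖ ≤ C) {e : EuclideanSpace ℝ (Fin 3)} (he : ‖e‖ = 1)
    (hinv : ∀ (t : ℝ) (x : EuclideanSpace ℝ (Fin 3)) (δ : ℝ), v t (x + δ • e) = v t x)
    {I : ℝ≥0∞} (hI : I ≠ ⊤)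
    (hA : ∀ r : ℝ, 0 < r → ∀ z : ℝ × EuclideanSpace ℝ (Fin 3), cknAEss r z v ≤ I)
    (t : ℝ) (x : EuclideanSpace ℝ (Fin 3)) : v t x = 0 := by
  -- the reflection exchanging `e₁` and `e`
  set e₁ : EuclideanSpace ℝ (Fin 3) := EuclideanSpace.single (1 : Fin 3) (1 : ℝ) with he₁
  have he₁n : ‖e₁‖ = ‖e‖ := by rw [he, he₁]; simp
  set R : EuclideanSpace ℝ (Fin 3) ≃ₗᵢ[ℝ] EuclideanSpace ℝ (Fin 3) := Submodule.reflection (ℝ ∙ (e₁ - e))ᗮ with hR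
  have hRe : R e₁ = e := Submodule.reflection_sub he₁n
  -- the conjugate field
  set w : ℝ → EuclideanSpace ℝ (Fin 3) → EuclideanSpace ℝ (Fin 3) := fun t y => R.symm (v t (R y))
    with hw
  have hw_smooth : ContDiff ℝ (⊤ : ℕ∞) (uncurry w) := by
    have h1 : ContDiff ℝ (⊤ : ℕ∞) fun p : ℝ × EuclideanSpace ℝ (Fin 3) => (p.1, R p.2) :=
      contDiff_fst.prodMk ((R : EuclideanSpace ℝ (Fin 3) →L[ℝ] EuclideanSpace ℝ (Fin 3)).contDiff.comp
        contDiff_snd)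
    exact (R.symm : EuclideanSpace ℝ (Fin 3) →L[ℝ] EuclideanSpace ℝ (Fin 3)).contDiff.comp (hv.comp h1)
  have hw_div : ∀ t, VectorCalculus.IsDivFree (w t) := fun t => by
    have h := (hdiv t).conj_linearIsometryEquiv R.symm
    simpa only [hw, LinearIsometryEquiv.symm_symm] using h
  have hw_mild : ∀ s t : ℝ, s < t → ∀ x,
      w t x = heatFlow (w s) (t - s) x - oseenDuhamel 1 s w w t x := by
    intro s t hst x
    have h1 : heatFlow (w s) (t - s) x = R.symm (heatFlow (v s) (t - s) (R x)) := by
      have h := heatFlow_conj_linearIsometryEquiv R.symm (v s) (t - s) x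
      simpa only [hw, LinearIsometryEquiv.symm_symm] using h
    have h2 : oseenDuhamel 1 s w w t x = R.symm (oseenDuhamel 1 s v v t (R x)) :=
      oseenDuhamel_symm_conj_linearIsometryEquiv R 1 s v v t x
    rw [h1, h2, ← map_sub, ← hmild s t hst (R x)]
  obtain ⟨C, hC⟩ := hbdd
  have hw_bdd : ∃ C : ℝ, ∀ t x, ‖w t x‖ ≤ C :=
    ⟨C, fun t x => by rw [hw]; simp only [LinearIsometryEquiv.norm_map]; exact hC t (R x)⟩
  have hw_inv : ∀ (t : ℝ) (x : EuclideanSpace ℝ (Fin 3)) (δ : ℝ),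
      w t (x + EuclideanSpace.single 1 δ) = w t x := by
    intro t x δ
    simp only [hw, map_add]
    rw [single_one_eq_smul, LinearIsometryEquiv.map_smul, hRe, hinv]
  have hw_A : ∀ r : ℝ, 0 < r → ∀ z : ℝ × EuclideanSpace ℝ (Fin 3), cknAEss r z w ≤ I := by
    intro r hr z
    have h := cknAEss_conj R.symm r z v
    simp only [LinearIsometryEquiv.symm_symm] at h
    rw [show w = fun t x => R.symm (v t (R x)) from rfl, h]
    exact hA r hr _
  have hzero := lineInvariant_eq_zero hw_smooth hw_div hw_mild hw_bdd hw_inv hI hw_A t (R.symm x)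
  have : v t x = R (w t (R.symm x)) := by simp [hw]
  rw [this, hzero, map_zero]

/-- **… for any nonzero translation-invariant direction** (rescale the parameter `δ`). [folklore] -/
theorem lineInvariant_eq_zero_of_ne_zero (hv : ContDiff ℝ (⊤ : ℕ∞) (uncurry v))
    (hdiv : ∀ t, VectorCalculus.IsDivFree (v t))
    (hmild : ∀ s t : ℝ, s < t → ∀ x, v t x = heatFlow (v s) (t - s) x - oseenDuhamel 1 s v v t x)
    (hbdd : ∃ C : ℝ, ∀ t x, ‖v t x‖ ≤ C) {e : EuclideanSpace ℝ (Fin 3)} (he : e ≠ 0)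
    (hinv : ∀ (t : ℝ) (x : EuclideanSpace ℝ (Fin 3)) (δ : ℝ), v t (x + δ • e) = v t x)
    {I : ℝ≥0∞} (hI : I ≠ ⊤)
    (hA : ∀ r : ℝ, 0 < r → ∀ z : ℝ × EuclideanSpace ℝ (Fin 3), cknAEss r z v ≤ I)
    (t : ℝ) (x : EuclideanSpace ℝ (Fin 3)) : v t x = 0 := by
  have hne : ‖e‖ ≠ 0 := norm_ne_zero_iff.2 he
  have hunit : ‖(‖e‖⁻¹ • e : EuclideanSpace ℝ (Fin 3))‖ = 1 := by
    rw [norm_smul, norm_inv, norm_norm, inv_mul_cancel₀ hne]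
  refine lineInvariant_eq_zero_of_unit hv hdiv hmild hbdd hunit (fun s y δ => ?_) hI hA t x
  rw [smul_smul]
  exact hinv s y (δ * ‖e‖⁻¹)

variable (v) in
/-- **EEL′ holds for every profile with a translation-invariant direction** — in the exact
hypothesis shape of `EternalSplit.typeIliouvilleNoTypeII_of_pressureFreeSlab_of_eternalLiouville`
(`hEEL`) plus invariance under `x ↦ x + δ e` for some `e ≠ 0`.  Unconditional; only the `A_ess`-clause
is used.  The open core of EEL′ is genuinely three-dimensional. [cite: KochNadirashviliSereginSverak2009, Thm 5.1 and proof of Thm 6.2 (arXiv:0709.3599 pp. 9, 13)] -/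
theorem eternalLiouvillePressureFree_lineInvariant_of_ne_zero
    (hv : ContDiff ℝ (⊤ : ℕ∞) (uncurry v)) (hdiv : ∀ t, VectorCalculus.IsDivFree (v t))
    (hmild : ∀ s t : ℝ, s < t → ∀ x, v t x = heatFlow (v s) (t - s) x - oseenDuhamel 1 s v v t x)
    (hbd : ∀ (t : ℝ) (x : EuclideanSpace ℝ (Fin 3)), ‖v t x‖ ≤ 2)
    (hI : ∃ I : ℝ≥0∞, I ≠ ⊤ ∧ ∀ r : ℝ, 0 < r → ∀ z : ℝ × EuclideanSpace ℝ (Fin 3),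
      cknAEss r z v ≤ I ∧ cknC r z v ≤ I ∧ cknE r z (fun s y => fderiv ℝ (v s) y) ≤ I)
    {e : EuclideanSpace ℝ (Fin 3)} (he : e ≠ 0)
    (hinv : ∀ (t : ℝ) (x : EuclideanSpace ℝ (Fin 3)) (δ : ℝ), v t (x + δ • e) = v t x) :
    v 0 0 = 0 := by
  obtain ⟨I, hItop, hball⟩ := hI
  exact lineInvariant_eq_zero_of_ne_zero hv hdiv hmild ⟨2, hbd⟩ he hinv hItop
    (fun r hr z => (hball r hr z).1) 0 0

end Summit.NavierStokesRegularity.NavierStokesRegularity.Theorems.TypeIliouvilleNoTypeII.TypeIIZoom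

end
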